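import Summits.NavierStokesRegularity.NavierStokesRegularity.Theorems.EulerZoomLiouvillePowerGaugeEulerLiouvillePowerClockRigidity
import Summits.NavierStokesRegularity.NavierStokesRegularity.Theorems.EulerZoomLiouvillePowerGaugeEulerLiouvilleClassicalProfileBetaZero

/-!
# Crux `EulerZoomLiouville.PowerGaugeEulerLiouville` (stmt-NavierStokesRegularity-19832), line `logtime-breathers` (T4):
# classical power clocks of RATE ZERO about `T₀ ≥ 0` (Euler's separable ansatz `u = W(y)/(T₀−τ)`) are trivial, u-only

Width seat `ns-ezl-w4` (power-clock rigidity, file IX).  `ae_eq_zero_of_gauge_of_classicalZeroRatePowerClock`: crux hypotheses (`0 < ρ ≤ ½`) +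
`(u, p)` classical + `u(τ, y) = (T₀−τ)^{γ−1} W((T₀−τ)^{−γ} y)` with `γ = 0` (`T₀ ≥ 0`) ⇒ `u = 0` a.e. — rigidity at `β = 0`
(`ClassicalProfile.eq_zero_of_locData_of_beta_zero`, `α = 1`) on the data of `PowerClockRigidity.exists_locData`.  (The weak-class twin with the
pressure ansatz is ns-ezl-w6's `SlowClock.separable_ae_eq_zero_past`.)  With `…PowerClockRigidityNeg` (`γ < 0`), `…Slow` (`0 < γ < 2/5`),
`…PowerClockRigidity` (`1/(2+ρ) < γ ≤ 2/3`) and `PastShape.ae_eq_zero_of_gauge_of_pastFastPowerClock` (`γ > ½ − ρ/5`) every classical power clock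
about `T₀ ≥ 0` with `γ ∉ [2/5, 1/(2+ρ)]` is trivial.

WHAT THIS IS NOT: not NS regularity, not the crux — a sub-stratum of T4 on the MODEL lattice; `--supports` stmt-19832. [folklore]
-/

noncomputable section

set_option linter.dupNamespace false

open MeasureTheory Set Filter Topology Metric Function TopologicalSpace
open scoped ENNReal NNReal RealInnerProductSpace ContDiff

namespace Summit.NavierStokesRegularity.NavierStokesRegularity.Theorems.PowerGaugeEulerLiouville

open Literature.Analysis Literature.Analysis.FunctionSpaces Literature.Analysis.FluidPDE

namespace PowerClockRigidity

variable {u : ℝ → EuclideanSpace ℝ (Fin 3) → EuclideanSpace ℝ (Fin 3)} {p : ℝ → EuclideanSpace ℝ (Fin 3) → ℝ}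
  {H : ℝ → EuclideanSpace ℝ (Fin 3) → EuclideanSpace ℝ (Fin 3) →L[ℝ] EuclideanSpace ℝ (Fin 3)}
  {T₀ g : ℝ} {W : EuclideanSpace ℝ (Fin 3) → EuclideanSpace ℝ (Fin 3)}

/-- **CLASSICAL POWER CLOCKS OF RATE `γ = 0` ABOUT ANY `T₀ ≥ 0` ARE TRIVIAL** (`u(τ, y) = (T₀−τ)^{−1} W(y)`; the profile equation is
`W + (W·∇)W + ∇P = 0`, rigidity at `β = 0`). [folklore] -/
theorem ae_eq_zero_of_gauge_of_classicalZeroRatePowerClock {ρ : ℝ} (hρ : 0 < ρ) (hρh : ρ ≤ 1 / 2) {c₀ : ℝ≥0}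
    (hH : HasWeakSpatialGradientOn (slab (EuclideanSpace ℝ (Fin 3)) (Iio 0) isOpen_Iio) u H)
    (hgauge : ∀ a : ℝ, 0 < a →
      ENNReal.ofReal (a ^ (2 * ρ)) * cknA a (0 : ℝ × EuclideanSpace ℝ (Fin 3)) u +
          ENNReal.ofReal (a ^ ρ) * cknE a (0 : ℝ × EuclideanSpace ℝ (Fin 3)) H +
        ENNReal.ofReal (a ^ (2 * ρ)) * cknD a (0 : ℝ × EuclideanSpace ℝ (Fin 3)) p ≤ (c₀ : ℝ≥0∞))
    (hcl : IsClassicalEulerSolutionOn (Iio 0) 0 u p) (hT₀ : 0 ≤ T₀) (hg : g = 0)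
    (hW : ∀ τ : ℝ, τ < 0 → ∀ y, u τ y = (T₀ - τ) ^ (g - 1) • W ((T₀ - τ) ^ (-g) • y)) :
    uncurry u =ᵐ[volume.restrict (Iio (0 : ℝ) ×ˢ (univ : Set (EuclideanSpace ℝ (Fin 3))))] 0 := by
  have hρ1 : ρ < 1 := by linarith
  subst hg
  obtain ⟨P, c', hP1, heq, hA, hE, hD⟩ :=
    exists_locData hρ hρh hH hgauge hcl hT₀ le_rfl (by norm_num) hW
  have hW1 : ContDiff ℝ 1 W := (PowerClock.contDiff_profile hcl hT₀ hW).of_le (by norm_num)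
  have hdiv := PowerClock.isDivFree_profile hcl hT₀ hW
  have hW0 : W = 0 :=
    ClassicalProfile.eq_zero_of_locData_of_beta_zero hρ hρ1 hW1 hP1 hdiv (α := 1 - 0) (by norm_num) heq hA hE hD
  filter_upwards [ae_restrict_mem (measurableSet_Iio.prod MeasurableSet.univ)] with q hq
  rw [mem_prod, mem_Iio] at hq
  show u q.1 q.2 = 0
  rw [hW q.1 hq.1 q.2, hW0, Pi.zero_apply, smul_zero]

end PowerClockRigidity

end Summit.NavierStokesRegularity.NavierStokesRegularity.Theorems.PowerGaugeEulerLiouville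

end
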